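import Summits.ValiantsHypothesis.ValiantsHypothesis.Theorems.GrenetZeonDualUnipotentThreeHalvesSlowCoreLedger

/-!
# GAUGE ROW for `GrenetZeon.DualUnipotentThreeHalves` (stmt-ValiantsHypothesis-24318), part 1/2 — the SYMBOLIC GAUGE FORMULA and the hook family `gaugeMat a C = a•J + [C,J]` (= `W(m)` of eng-2)

§1 `gauge_pow` — the SYMBOLIC GAUGE FORMULA in any algebra: `C² = 0`, `C X C = 0` ⇒ for every `L`,
   `(a•X + [C,X])^(L+2) = a^L • (a²•X^(L+2) + a•[C, X^(L+2)] − C X^(L+2) C)` (for invertible `a` this is `g (aX)^{L+2} g⁻¹`, `g = 1 + C/a`; it holds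
   with NO invertibility, so it prices the boundary `a = 0` too); `gauge_sq`, `gauge_pow_eq_zero`.
§2 the hook block `𝒳₁ = {rows ≥ h} × {cols ≤ h−2}` (0-indexed; `h = ⌊m/2⌋+1`, `hk`, `HookSupp`), `Jm`, `hook_mul_hook`, `hook_J_hook`, `Jm_pow_eq_zero`, and
   `gaugeMat a C := a•J + [C,J]`; ★ `gaugeMat_pow_eq_zero : gaugeMat a C ^ m = 0` for EVERY `m ≥ 2`, every `a`, every hook-supported `C`
   (IDENTIFICATION, paper: `{gaugeMat a C} = ℂJ_m ⊕ [𝒳₁, J_m] = W(m)` of ENGINE-iota §3 — so ★ is the nilpotency theorem of eng-2 for the extremiser family, all `m`).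
§3 `gaugeMat_map` (ring homs), so line substitution commutes with the construction.  Part 2/2 (`…LongMassGauge`) builds the row `gaugePencil` and its ledger.

Status / honest framing (val-idea-27 g7's words, desk #377 WORDS OF RECORD): «the (c)-LEDGER exists at price 2n+1 on the GAUGE FAMILY (row r4,
hook-supported gauge pencils — the RelCert providers of V30); a SUPPORT LEMMA of the mass-cut line, never an `IrreducibleInv` constituent ⇒ NOT progress on
(c) `LongMassSlowLawInv` (RESEARCH — OPEN)».  This file asserts no law; everything is sorry-free kernel arithmetic about ONE family of pencils plus one
certified ledger move.  Crux 24318 / S3 `SlowPlane` / R2ᵖ / IRR / RED / (c) OPEN; 8062 OPEN; VP ≠ VNP is NOT proved.  Helper (`--supports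
stmt-ValiantsHypothesis-24318`).  Port (val-lit-p3 g18, desk #377 (G1) HAND 2) of val-idea-27 g7's `Cruxes/DualUnipotentThreeHalves/GaugeRow.lean` REV 2
(sha16 133a4a6739d5001d, 454 l., imports only ✓ `…SlowCoreLedger`, 0 sorry) — bodies VERBATIM by name, namespace `…Cruxes.DualUnipotentThreeHalves.GaugeRow`
→ `…Theorems.GrenetZeon.GaugeRow`, split in two files for the 400-line convention; critic of record val-idea-crit-7 g3; lead val-port-2 g3 (`slow_core` rev 2).
Credit: mathematics and kernel proofs val-idea-27 g7; cell data CENSUS-EXTREMISERS X4 / ENGINE-iota §3 (val-sym-eng-2); `Ledger`/`RelCert` vocabulary val-idea-26 g5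
(✓ `…SlowCoreLedger`, val-port-2 g3).  No instances, no notation, no named facts.
-/

-- single-conjunct layout: Sub = Summit, duplicated namespace component intended (the name is mandated)
set_option linter.dupNamespace false
set_option autoImplicit false

noncomputable section

namespace Summit.ValiantsHypothesis.ValiantsHypothesis.Theorems.GrenetZeon.GaugeRow

open MvPolynomial Matrix
open scoped BigOperators
open Summit.ValiantsHypothesis.ValiantsHypothesis.Cruxes.TwoDimCoefficients.DimTwoCases
  (AffMat IsAffine aeval_line_of_totalDegree_le_one totalDegree_aeval_line_le_one)
open Summit.ValiantsHypothesis.ValiantsHypothesis.Theorems.GrenetZeon.RadicalSplit (lineSubst FlagCheap pencilAlg)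
open Summit.ValiantsHypothesis.ValiantsHypothesis.Theorems.GrenetZeon.SlowCore (Slow SlowR slow_of_slowR Ledger RelCert slow_of_relCert)

variable {S T : Type*} {m : ℕ}

/-! ## §1 The symbolic gauge formula -/

/-- ★ **SYMBOLIC GAUGE FORMULA.**  In any algebra: `C² = 0`, `C X C = 0` ⇒
`(a•X + [C,X])^(L+2) = a^L • (a²•X^(L+2) + a•[C, X^(L+2)] − C·X^(L+2)·C)` for every `L`.  (For invertible `a` this is conjugation of `(aX)^(L+2)`
by `g = 1 + C/a`, `g⁻¹ = 1 − C/a`; the identity needs no invertibility.) [val-idea-27 g7] -/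
theorem gauge_pow {R A : Type*} [CommRing R] [Ring A] [Algebra R A] (a : R) (X C : A)
    (hCC : C * C = 0) (hCXC : C * X * C = 0) (L : ℕ) :
    (a • X + (C * X - X * C)) ^ (L + 2)
      = a ^ L • (a ^ 2 • X ^ (L + 2) + a • (C * X ^ (L + 2) - X ^ (L + 2) * C) - C * X ^ (L + 2) * C) := by
  have hCXC' : C * (X * C) = 0 := by rw [← mul_assoc]; exact hCXC
  have hCCt : ∀ M : A, C * (C * M) = 0 := fun M => by rw [← mul_assoc, hCC, zero_mul]
  have hCXCt : ∀ M : A, C * (X * (C * M)) = 0 := fun M => by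
    rw [← mul_assoc, ← mul_assoc, hCXC, zero_mul]
  induction L with
  | zero =>
      simp only [pow_zero, pow_succ, one_mul, one_smul, add_mul, mul_add, sub_mul, mul_sub, smul_mul_assoc,
        mul_smul_comm, smul_add, smul_sub, smul_smul, mul_assoc, hCXC', hCCt, hCXCt, mul_zero,
        sub_zero, add_zero, zero_add]
      module
  | succ L ih =>
      rw [pow_succ, ih, show L + 1 + 2 = L + 2 + 1 from rfl, pow_succ X (L + 2)]
      set P := X ^ (L + 2) with hP
      simp only [pow_succ, add_mul, mul_add, sub_mul, mul_sub, smul_mul_assoc,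
        mul_smul_comm, smul_add, smul_sub, smul_smul, mul_assoc, hCXC', hCCt, mul_zero,
        smul_zero, sub_zero]
      module

/-- The square: `(a•X + [C,X])² = a²X² + a[C,X²] − C X² C`. -/
theorem gauge_sq {R A : Type*} [CommRing R] [Ring A] [Algebra R A] (a : R) (X C : A)
    (hCC : C * C = 0) (hCXC : C * X * C = 0) :
    (a • X + (C * X - X * C)) ^ 2 = a ^ 2 • X ^ 2 + a • (C * X ^ 2 - X ^ 2 * C) - C * X ^ 2 * C := by
  have h := gauge_pow a X C hCC hCXC 0
  rw [pow_zero, one_smul] at h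
  exact h

/-- Nilpotency is inherited: `X^(L+2) = 0 ⇒ (a•X + [C,X])^(L+2) = 0`. -/
theorem gauge_pow_eq_zero {R A : Type*} [CommRing R] [Ring A] [Algebra R A] (a : R) (X C : A)
    (hCC : C * C = 0) (hCXC : C * X * C = 0) (L : ℕ) (hX : X ^ (L + 2) = 0) :
    (a • X + (C * X - X * C)) ^ (L + 2) = 0 := by
  rw [gauge_pow a X C hCC hCXC L, hX]
  simp

/-! ## §2 The hook block `𝒳₁`, the Jordan block `J_m`, and `gaugeMat a C = a•J + [C,J]` (= eng-2's `W(m)`) -/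

variable {S T : Type*} {m : ℕ}

/-- `h(m) = ⌊m/2⌋ + 1` (ENGINE-iota §3). -/
def hk (m : ℕ) : ℕ := m / 2 + 1

/-- HOOK SUPPORT (0-indexed): `C i j ≠ 0 ⇒ i ≥ h ∧ j ≤ h − 2` — the block `𝒳₁` of rows `h+1..m` × columns `1..h−1` in ENGINE-iota's 1-indexed
coordinates; `[𝒳₁, J_m] = 𝓛_h`. -/
def HookSupp [Zero S] (C : Matrix (Fin m) (Fin m) S) : Prop :=
  ∀ i j, C i j ≠ 0 → hk m ≤ (i : ℕ) ∧ (j : ℕ) + 2 ≤ hk m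

/-- `J_m = Σ_s E_{s,s+1}` over any semiring. -/
def Jm (m : ℕ) [Zero S] [One S] : Matrix (Fin m) (Fin m) S := fun i j => if (j : ℕ) = (i : ℕ) + 1 then 1 else 0

/-- `𝒳₁ · 𝒳₁ = 0`. -/
theorem hook_mul_hook [Ring S] {C C' : Matrix (Fin m) (Fin m) S} (hC : HookSupp C) (hC' : HookSupp C') : C * C' = 0 := by
  ext i j
  rw [Matrix.mul_apply, Matrix.zero_apply]
  refine Finset.sum_eq_zero fun k _ => ?_
  by_cases h1 : C i k = 0
  · rw [h1, zero_mul]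
  by_cases h2 : C' k j = 0
  · rw [h2, mul_zero]
  have e1 := (hC i k h1).2
  have e2 := (hC' k j h2).1
  omega

/-- `𝒳₁ · J · 𝒳₁ = 0`. -/
theorem hook_J_hook [Ring S] {C C' : Matrix (Fin m) (Fin m) S} (hC : HookSupp C) (hC' : HookSupp C') :
    C * (Jm m * C') = 0 := by
  ext i j
  rw [Matrix.mul_apply, Matrix.zero_apply]
  refine Finset.sum_eq_zero fun k _ => ?_
  by_cases h1 : C i k = 0
  · rw [h1, zero_mul]
  have hk2 := (hC i k h1).2
  suffices h : (Jm m * C' : Matrix (Fin m) (Fin m) S) k j = 0 by rw [h, mul_zero]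
  rw [Matrix.mul_apply]
  refine Finset.sum_eq_zero fun l _ => ?_
  by_cases h3 : C' l j = 0
  · rw [h3, mul_zero]
  have hl := (hC' l j h3).1
  have hJ : (Jm m : Matrix (Fin m) (Fin m) S) k l = 0 := by
    simp only [Jm]
    rw [if_neg]
    omega
  rw [hJ, zero_mul]

/-- Support of the powers of `J_m`: `(J^k) i j ≠ 0 ⇒ j = i + k`. -/
theorem Jm_pow_apply_ne_zero [Ring S] (k : ℕ) :
    ∀ i j : Fin m, ((Jm m : Matrix (Fin m) (Fin m) S) ^ k) i j ≠ 0 → (j : ℕ) = (i : ℕ) + k := by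
  induction k with
  | zero =>
      intro i j h
      rw [pow_zero, Matrix.one_apply] at h
      by_cases e : i = j
      · subst e; simp
      · exact absurd (if_neg e) h
  | succ k ih =>
      intro i j h
      rw [pow_succ, Matrix.mul_apply] at h
      obtain ⟨l, _, hl⟩ := Finset.exists_ne_zero_of_sum_ne_zero h
      have h1 : ((Jm m : Matrix (Fin m) (Fin m) S) ^ k) i l ≠ 0 := left_ne_zero_of_mul hl
      have h2 : (Jm m : Matrix (Fin m) (Fin m) S) l j ≠ 0 := right_ne_zero_of_mul hl
      have e1 := ih i l h1
      have e2 : (j : ℕ) = (l : ℕ) + 1 := by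
        simp only [Jm] at h2
        by_contra hne
        exact h2 (if_neg hne)
      omega

/-- `J_m ^ m = 0`. -/
theorem Jm_pow_eq_zero [Ring S] : ((Jm m : Matrix (Fin m) (Fin m) S)) ^ m = 0 := by
  ext i j
  rw [Matrix.zero_apply]
  by_contra h
  have e := Jm_pow_apply_ne_zero m i j h
  have := j.isLt
  omega

/-- **`gaugeMat a C = a•J_m + [C, J_m]`** — for hook-supported `C` these are exactly the members of eng-2's `W(m) = ℂJ_m ⊕ 𝓛_h` (X4). -/
def gaugeMat [CommRing S] (a : S) (C : Matrix (Fin m) (Fin m) S) : Matrix (Fin m) (Fin m) S :=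
  a • Jm m + (C * Jm m - Jm m * C)

/-- The gauge formula for `W(m)`: every power of `a•J + [C,J]` is `a^L•(a²J^{L+2} + a[C,J^{L+2}] − C J^{L+2} C)`. -/
theorem gaugeMat_pow [CommRing S] (a : S) {C : Matrix (Fin m) (Fin m) S} (hC : HookSupp C) (L : ℕ) :
    gaugeMat a C ^ (L + 2) = a ^ L • (a ^ 2 • (Jm m) ^ (L + 2) + a • (C * (Jm m) ^ (L + 2) - (Jm m) ^ (L + 2) * C)
      - C * (Jm m) ^ (L + 2) * C) :=
  gauge_pow a (Jm m) C (hook_mul_hook hC hC) (by rw [Matrix.mul_assoc]; exact hook_J_hook hC hC) L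

/-- ★ **eng-2's nilpotency theorem for the extremiser family, all `m`** (ENGINE-iota §3, port target): `(a•J_m + [C,J_m])^m = 0` for every `m ≥ 2`,
every scalar `a` and every hook-supported `C`, over any commutative ring. -/
theorem gaugeMat_pow_eq_zero [CommRing S] (a : S) {C : Matrix (Fin m) (Fin m) S} (hC : HookSupp C) (hm : 2 ≤ m) :
    gaugeMat a C ^ m = 0 := by
  obtain ⟨L, rfl⟩ : ∃ L, m = L + 2 := ⟨m - 2, by omega⟩
  rw [gaugeMat_pow a hC L, Jm_pow_eq_zero]
  simp

/-! ## §3 Functoriality (line substitution commutes with the construction) -/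

/-- Hook support is preserved by any zero-preserving map of entries. [val-idea-27 g7] -/
theorem HookSupp.map [Zero S] [Zero T] {C : Matrix (Fin m) (Fin m) S} (hC : HookSupp C) (f : S → T) (hf : f 0 = 0) :
    HookSupp (C.map f) :=
  fun i j h => hC i j (fun h0 => h (by rw [Matrix.map_apply, h0, hf]))

/-- `J_m` is preserved by ring homomorphisms of entries. [folklore] -/
theorem Jm_map [Semiring S] [Semiring T] (f : S →+* T) : (Jm m : Matrix (Fin m) (Fin m) S).map f = Jm m := by
  ext i j
  simp only [Matrix.map_apply, Jm]
  split_ifs <;> simp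

/-- `gaugeMat` commutes with ring homomorphisms of entries (so with line substitution). [val-idea-27 g7] -/
theorem gaugeMat_map [CommRing S] [CommRing T] (f : S →+* T) (a : S) (C : Matrix (Fin m) (Fin m) S) :
    (gaugeMat a C).map f = gaugeMat (f a) (C.map f) := by
  have hJ : (Jm m : Matrix (Fin m) (Fin m) S).map f = Jm m := Jm_map f
  have hs : (a • (Jm m : Matrix (Fin m) (Fin m) S)).map f = f a • (Jm m : Matrix (Fin m) (Fin m) T) := by
    ext i j
    have e := congr_fun (congr_fun hJ i) j
    rw [Matrix.map_apply] at e
    rw [Matrix.map_apply, Matrix.smul_apply, Matrix.smul_apply, smul_eq_mul, smul_eq_mul, map_mul, e]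
  rw [show (gaugeMat a C).map f = f.mapMatrix (gaugeMat a C) from rfl, gaugeMat, map_add, map_sub, map_mul, map_mul]
  simp only [RingHom.mapMatrix_apply, hJ, hs]
  rfl

end Summit.ValiantsHypothesis.ValiantsHypothesis.Theorems.GrenetZeon.GaugeRow

end
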